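import Mathlib
import Summits.ResolutionOfSingularities.ResolutionOfSingularities.Theorems.WeightedInvariantLocalWeightedDropWeierstrassForm
import Literature.AlgebraicGeometry.Resolution.CompleteFiniteness
import Literature.AlgebraicGeometry.Resolution.FormalFibres
import Summits.ResolutionOfSingularities.ResolutionOfSingularities.Theorems.WeightedInvariantLocalWeightedDropTOT2BranchValuation

/-!
# TOT2-LINE (P3) brick B4, kernel part 1: a PAIR OF WEIERSTRASS DIVISORS in `k⟦x,v,w⟧` — uniqueness and generation

Sub-problem `ResolutionOfSingularities`, ENGINE crux `stmt-ResolutionOfSingularities-8899` (`LocalWeightedDrop`), skeleton v35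
(2e806da509994632), registered stub `stub_conflictBudget` (P3), bricks B4-1 … B4-4 of the typed split
`L/res-L1-w43-stub-2/g6/P3_split_v1.lean` (downward transport of the top-locus primes through the four chart maps).
[OURS · L1 W4.3 · chain w43 · res-L1-w43-lead-1 g6; def-free commutative algebra over Mathlib's Weierstrass division
(`PowerSeries.IsWeierstrassDivisorAt`) and the tree's complete Nakayama lemma (`Matsumura1987_8_4`); nothing here is a statement
of any manuscript; AI-produced, gate-checked, weaker than expert review.]

Frame: `x = X 0`, `v = X 1`, `w = X 2` in `R₃ = k⟦x,v,w⟧`.  A series `G_v` FREE OF `w` whose restriction to `x = w = 0` has order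
exactly `α` and a series `G_w` whose restriction to `x = v = 0` has order exactly `β` form a "Weierstrass pair".

* `eq_zero_of_mem_span_pair` (UNIQUENESS): a series of `v`-degree `< α` and `w`-degree `< β` lying in the ideal `(G_v, G_w)` is
  zero (Mathlib's uniqueness of Weierstrass division, in `w` over `k⟦x,v⟧` and then in `v` over `k⟦x⟧`).
* `exists_boxPoly_sub_mem` (GENERATION): if `v^α, w^β ∈ J + (x)` for an ideal `J ≠ R₃`, every series is congruent modulo `J`
  to a finite sum `Σ_{i<α, j<β} r_{ij}(x)·v^i w^j` with `r_{ij} ∈ k⟦x⟧` (complete Nakayama over `k⟦x⟧` for the module `R₃ ⧸ J`).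
-/

set_option linter.dupNamespace false -- mandated namespace of this single-conjunct summit

noncomputable section

namespace Summit.ResolutionOfSingularities.ResolutionOfSingularities.Theorems

namespace TOT2Chart

open MvPowerSeries IsLocalRing

variable {k : Type} [Field k]

/-! ## §1 Reading the split `k⟦x', y⟧ ≃ k⟦x'⟧⟦T⟧` (`WeierstrassForm.exists_splitEquiv`) -/

section Split

variable {m : ℕ} {e : MvPowerSeries (Fin (m + 1)) k ≃+* PowerSeries (MvPowerSeries (Fin m) k)}
  (he : ∀ (F : MvPowerSeries (Fin (m + 1)) k) (n : ℕ) (β : Fin m →₀ ℕ),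
    coeff β (PowerSeries.coeff n (e F)) =
      coeff (Finsupp.embDomain (Fin.succAboveEmb (Fin.last m)) β + Finsupp.single (Fin.last m) n) F)
include he

/-- A series with no monomial of `y`-degree `≥ β` splits to a power series with vanishing coefficients in degrees `≥ β`. -/
theorem coeff_split_eq_zero_of_le {F : MvPowerSeries (Fin (m + 1)) k} {β : ℕ}
    (hF : ∀ E : Fin (m + 1) →₀ ℕ, β ≤ E (Fin.last m) → coeff E F = 0) {n : ℕ} (hn : β ≤ n) :
    PowerSeries.coeff n (e F) = 0 := by
  ext γ
  rw [he, map_zero]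
  exact hF _ (by rwa [TschirnhausForm.emb_add_single_last])

/-- Such a series splits to (the coercion of) a polynomial of degree `< β`. -/
theorem exists_polynomial_of_le {F : MvPowerSeries (Fin (m + 1)) k} {β : ℕ}
    (hF : ∀ E : Fin (m + 1) →₀ ℕ, β ≤ E (Fin.last m) → coeff E F = 0) :
    ∃ p : Polynomial (MvPowerSeries (Fin m) k), p.degree < β ∧ (p : PowerSeries (MvPowerSeries (Fin m) k)) = e F := by
  classical
  refine ⟨∑ n ∈ Finset.range β, Polynomial.monomial n (PowerSeries.coeff n (e F)), ?_, ?_⟩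
  · refine lt_of_le_of_lt (Polynomial.degree_sum_le _ _) ((Finset.sup_lt_iff (WithBot.bot_lt_coe β)).mpr ?_)
    intro n hn
    exact lt_of_le_of_lt (Polynomial.degree_monomial_le _ _) (WithBot.coe_lt_coe.mpr (Finset.mem_range.mp hn))
  · refine PowerSeries.ext fun n => ?_
    rw [Polynomial.coeff_coe, Polynomial.finsetSum_coeff]
    simp only [Polynomial.coeff_monomial]
    rw [Finset.sum_ite_eq' (Finset.range β) n]
    split_ifs with h
    · rfl
    · exact (coeff_split_eq_zero_of_le he hF (not_lt.mp (fun h' => h (Finset.mem_range.mpr h')))).symm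

/-- A series free of the last variable splits to a constant. -/
theorem split_eq_C_of_free {G : MvPowerSeries (Fin (m + 1)) k} (hG : ∀ E : Fin (m + 1) →₀ ℕ, E (Fin.last m) ≠ 0 → coeff E G = 0) :
    e G = PowerSeries.C (PowerSeries.coeff 0 (e G)) := by
  refine PowerSeries.ext fun n => ?_
  by_cases hn : n = 0
  · subst hn; rw [PowerSeries.coeff_zero_C]
  · rw [PowerSeries.coeff_C, if_neg hn]
    exact coeff_split_eq_zero_of_le he (β := 1) (fun E hE => hG E (by omega)) (Nat.one_le_iff_ne_zero.mpr hn)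

/-- The pure coefficients of the split: `[x'^0]([T^n] e G) = [y^n] G`. -/
theorem constantCoeff_coeff_split (G : MvPowerSeries (Fin (m + 1)) k) (n : ℕ) :
    constantCoeff (PowerSeries.coeff n (e G)) = coeff (Finsupp.single (Fin.last m) n) G := by
  rw [← coeff_zero_eq_constantCoeff_apply, he, Finsupp.embDomain_zero, zero_add]

/-- **A series whose restriction to the `y`-axis has order exactly `β` splits to a Weierstrass divisor of order `β`** at the maximal
ideal of `k⟦x'⟧`. -/
theorem isWeierstrassDivisorAt_split {G : MvPowerSeries (Fin (m + 1)) k} {β : ℕ}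
    (hlow : ∀ n < β, coeff (Finsupp.single (Fin.last m) n) G = 0) (htop : coeff (Finsupp.single (Fin.last m) β) G ≠ 0) :
    (e G).IsWeierstrassDivisorAt (maximalIdeal (MvPowerSeries (Fin m) k)) ∧
      ((e G).map (Ideal.Quotient.mk (maximalIdeal (MvPowerSeries (Fin m) k)))).order.toNat = β := by
  refine Literature.RingTheory.HenselLemma.isWeierstrassDivisorAt_of_coeff_mem (fun i hi => ?_) ?_
    (IsLocalRing.maximalIdeal.isMaximal _).ne_top
  · rw [WeierstrassForm.mem_maximalIdeal_iff, constantCoeff_coeff_split he, hlow i hi]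
  · rw [isUnit_iff_constantCoeff, constantCoeff_coeff_split he, isUnit_iff_ne_zero]
    exact htop

end Split

/-! ## §2 Uniqueness: a box polynomial in the ideal of a Weierstrass pair vanishes -/

/-- One variable down: in `k⟦x⟧⟦v⟧`, a series of `v`-degree `< α` divisible by a Weierstrass divisor of order `α` is zero. -/
theorem eq_zero_of_dvd_of_order_two {α : ℕ} {G R : MvPowerSeries (Fin 2) k}
    (hlow : ∀ n < α, coeff (Finsupp.single (1 : Fin 2) n) G = 0) (htop : coeff (Finsupp.single (1 : Fin 2) α) G ≠ 0)
    (hR : ∀ E : Fin 2 →₀ ℕ, α ≤ E 1 → coeff E R = 0) (hdvd : G ∣ R) : R = 0 := by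
  obtain ⟨e, he⟩ := WeierstrassForm.exists_splitEquiv k 1
  haveI := WeierstrassForm.isAdicComplete_maximalIdeal k 1
  have hlast : Fin.last 1 = (1 : Fin 2) := rfl
  obtain ⟨hdiv, hord⟩ := isWeierstrassDivisorAt_split he (G := G) (β := α) (by rw [hlast]; exact hlow) (by rw [hlast]; exact htop)
  obtain ⟨p, hpdeg, hp⟩ := exists_polynomial_of_le he (F := R) (β := α) (by rw [hlast]; exact hR)
  obtain ⟨q, hq⟩ := hdvd
  have hmul : e G * e q = (p : PowerSeries (MvPowerSeries (Fin 1) k)) := by rw [← map_mul, ← hq, hp]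
  have h0 := (hdiv.eq_zero_of_mul_eq (by rw [hord]; exact hpdeg) hmul).2
  have : e R = 0 := by rw [← hp, h0, Polynomial.coe_zero]
  simpa using congrArg e.symm this

/-- **UNIQUENESS FOR A WEIERSTRASS PAIR.**  In `k⟦x,v,w⟧` (`x,v,w = X 0, X 1, X 2`) let `G_v` be free of `w` with `G_v(0,v,0)` of order
exactly `α`, and `G_w` with `G_w(0,0,w)` of order exactly `β`.  A series with no monomial of `v`-degree `≥ α` and none of `w`-degree
`≥ β` that lies in the ideal `(G_v, G_w)` is zero. -/
theorem eq_zero_of_mem_span_pair {α β : ℕ} {Gv Gw R : MvPowerSeries (Fin 3) k}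
    (hGv_free : ∀ E : Fin 3 →₀ ℕ, E 2 ≠ 0 → coeff E Gv = 0)
    (hGv_low : ∀ n < α, coeff (Finsupp.single (1 : Fin 3) n) Gv = 0) (hGv_top : coeff (Finsupp.single (1 : Fin 3) α) Gv ≠ 0)
    (hGw_low : ∀ n < β, coeff (Finsupp.single (2 : Fin 3) n) Gw = 0) (hGw_top : coeff (Finsupp.single (2 : Fin 3) β) Gw ≠ 0)
    (hRv : ∀ E : Fin 3 →₀ ℕ, α ≤ E 1 → coeff E R = 0) (hRw : ∀ E : Fin 3 →₀ ℕ, β ≤ E 2 → coeff E R = 0)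
    (hR : R ∈ Ideal.span ({Gv, Gw} : Set (MvPowerSeries (Fin 3) k))) : R = 0 := by
  classical
  obtain ⟨a, b, hab⟩ := Ideal.mem_span_pair.mp hR
  obtain ⟨e, he⟩ := WeierstrassForm.exists_splitEquiv k 2
  haveI := WeierstrassForm.isAdicComplete_maximalIdeal k 2
  have hlast : Fin.last 2 = (2 : Fin 3) := rfl
  obtain ⟨hdiv, hord⟩ := isWeierstrassDivisorAt_split he (G := Gw) (β := β) (by rw [hlast]; exact hGw_low)
    (by rw [hlast]; exact hGw_top)
  -- `e R` is a polynomial of degree `< β`, `e Gv` is a constant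
  obtain ⟨pR, hpRdeg, hpR⟩ := exists_polynomial_of_le he (F := R) (β := β) (by rw [hlast]; exact hRw)
  have hGvC := split_eq_C_of_free he (G := Gv) (by rw [hlast]; exact hGv_free)
  set gv : MvPowerSeries (Fin 2) k := PowerSeries.coeff 0 (e Gv) with hgv
  -- divide `e a` by `e Gw`
  have hwd := hdiv.isWeierstrassDivisionAt_div_mod (e a)
  set q := hdiv.div (e a)
  set r := hdiv.mod (e a)
  have hrdeg : r.degree < β := by rw [← hord]; exact hwd.degree_lt
  -- `e R - r·C gv = e Gw · (q · C gv + e b)`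
  have hkey : e Gw * (q * PowerSeries.C gv + e b) = ((pR - r * Polynomial.C gv : Polynomial _) : PowerSeries _) := by
    rw [Polynomial.coe_sub, Polynomial.coe_mul, Polynomial.coe_C, hpR]
    have h1 : e R = e a * e Gv + e b * e Gw := by rw [← hab, map_add, map_mul, map_mul]
    rw [h1, hGvC, hwd.eq_mul_add]
    ring
  have hdeg2 : (pR - r * Polynomial.C gv).degree <
      ((e Gw).map (Ideal.Quotient.mk (maximalIdeal (MvPowerSeries (Fin 2) k)))).order.toNat := by
    rw [hord, Polynomial.degree_lt_iff_coeff_zero]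
    intro n hn
    have hn' : (β : WithBot ℕ) ≤ n := by exact_mod_cast hn
    rw [Polynomial.coeff_sub, Polynomial.coeff_mul_C, Polynomial.coeff_eq_zero_of_degree_lt (lt_of_lt_of_le hpRdeg hn'),
      Polynomial.coeff_eq_zero_of_degree_lt (lt_of_lt_of_le hrdeg hn'), zero_mul, sub_zero]
  have hzero := (hdiv.eq_zero_of_mul_eq hdeg2 hkey).2
  rw [sub_eq_zero] at hzero
  -- coefficientwise in `k⟦x,v⟧`: `[T^j] e R = r_j · gv`, of `v`-degree `< α` and divisible by the Weierstrass divisor `gv`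
  have hcoef : ∀ j, PowerSeries.coeff j (e R) = 0 := by
    intro j
    have hj : PowerSeries.coeff j (e R) = r.coeff j * gv := by
      rw [← hpR, Polynomial.coeff_coe, hzero, Polynomial.coeff_mul_C]
    refine eq_zero_of_dvd_of_order_two (G := gv) (α := α) ?_ ?_ ?_ ⟨r.coeff j, by rw [hj, mul_comm]⟩
    · intro n hn
      rw [hgv, he, Finsupp.embDomain_single]
      have : (Fin.succAboveEmb (Fin.last 2)) (1 : Fin 2) = (1 : Fin 3) := by decide
      rw [this, hlast, Finsupp.single_zero, add_zero]
      exact hGv_low n hn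
    · rw [hgv, he, Finsupp.embDomain_single]
      have : (Fin.succAboveEmb (Fin.last 2)) (1 : Fin 2) = (1 : Fin 3) := by decide
      rw [this, hlast, Finsupp.single_zero, add_zero]
      exact hGv_top
    · intro E hE
      rw [he]
      apply hRv
      have : (Finsupp.embDomain (Fin.succAboveEmb (Fin.last 2)) E + Finsupp.single (Fin.last 2) j) 1 = E 1 := by
        have h1 : (1 : Fin 3) = Fin.castSucc (1 : Fin 2) := rfl
        rw [h1, TschirnhausForm.emb_add_single_castSucc]
      rwa [this]
  have : e R = 0 := PowerSeries.ext fun j => by rw [hcoef, map_zero]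
  simpa using congrArg e.symm this

/-! ## §3 Generation: box polynomials over `k⟦x⟧` span `k⟦x,v,w⟧ ⧸ J` when `v^α, w^β ∈ J + (x)` -/

/-- Monomial remainder: `G ≡ (its part of `X s`-degree `< n`) mod X s ^ n`. -/
theorem exists_sub_X_pow_mul {σ : Type} (s : σ) (n : ℕ) (G : MvPowerSeries σ k) :
    ∃ Q : MvPowerSeries σ k, ∀ E : σ →₀ ℕ, coeff E (G - X s ^ n * Q) = if E s < n then coeff E G else 0 := by
  classical
  let Rm : MvPowerSeries σ k := fun E => if E s < n then coeff E G else 0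
  have hRm : ∀ E, coeff E Rm = if E s < n then coeff E G else 0 := fun E => rfl
  have hdvd : (X s : MvPowerSeries σ k) ^ n ∣ G - Rm := by
    rw [X_pow_dvd_iff]
    intro E hE
    rw [map_sub, hRm, if_pos hE, sub_self]
  obtain ⟨Q, hQ⟩ := hdvd
  refine ⟨Q, fun E => ?_⟩
  rw [show G - X s ^ n * Q = Rm by rw [← hQ]; ring, hRm]

/-- **Box decomposition**: every series is `Σ_{i<α,j<β} c_{ij} v^i w^j + x·G₀ + v^α·G₁ + w^β·G₂` with CONSTANT `c_{ij}`. -/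
theorem exists_box_decomposition (α β : ℕ) (G : MvPowerSeries (Fin 3) k) :
    ∃ G₀ G₁ G₂ : MvPowerSeries (Fin 3) k,
      G = (∑ p : Fin α × Fin β, C (coeff (Finsupp.single 1 (p.1 : ℕ) + Finsupp.single 2 (p.2 : ℕ)) G) *
            (X 1 ^ (p.1 : ℕ) * X 2 ^ (p.2 : ℕ))) + X 0 * G₀ + X 1 ^ α * G₁ + X 2 ^ β * G₂ := by
  classical
  obtain ⟨G₀, h₀⟩ := exists_sub_X_pow_mul (0 : Fin 3) 1 G
  obtain ⟨G₁, h₁⟩ := exists_sub_X_pow_mul (1 : Fin 3) α (G - X 0 ^ 1 * G₀)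
  obtain ⟨G₂, h₂⟩ := exists_sub_X_pow_mul (2 : Fin 3) β (G - X 0 ^ 1 * G₀ - X 1 ^ α * G₁)
  refine ⟨G₀, G₁, G₂, ?_⟩
  rw [pow_one] at h₁ h₂ h₀
  have hB : ∀ E : Fin 3 →₀ ℕ, coeff E (G - X 0 * G₀ - X 1 ^ α * G₁ - X 2 ^ β * G₂) =
      if E 0 = 0 ∧ E 1 < α ∧ E 2 < β then coeff E G else 0 := by
    intro E
    rw [h₂, h₁, h₀]
    by_cases h0 : E 0 = 0 <;> by_cases h1 : E 1 < α <;> by_cases h2 : E 2 < β <;> simp [h0, h1, h2]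
  suffices hsum : G - X 0 * G₀ - X 1 ^ α * G₁ - X 2 ^ β * G₂ =
      ∑ p : Fin α × Fin β, C (coeff (Finsupp.single 1 (p.1 : ℕ) + Finsupp.single 2 (p.2 : ℕ)) G) *
        (X 1 ^ (p.1 : ℕ) * X 2 ^ (p.2 : ℕ)) by
    rw [← hsum]; ring
  ext E
  rw [hB, map_sum]
  have hterm : ∀ p : Fin α × Fin β, coeff E (C (coeff (Finsupp.single 1 (p.1 : ℕ) + Finsupp.single 2 (p.2 : ℕ)) G) *
      (X 1 ^ (p.1 : ℕ) * X 2 ^ (p.2 : ℕ)) : MvPowerSeries (Fin 3) k) =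
      if E = Finsupp.single 1 (p.1 : ℕ) + Finsupp.single 2 (p.2 : ℕ) then
        coeff (Finsupp.single 1 (p.1 : ℕ) + Finsupp.single 2 (p.2 : ℕ)) G else 0 := by
    intro p
    rw [X_pow_eq, X_pow_eq, monomial_mul_monomial, one_mul, coeff_C_mul, coeff_monomial]
    split_ifs <;> simp
  simp_rw [hterm]
  by_cases hbox : E 0 = 0 ∧ E 1 < α ∧ E 2 < β
  · rw [if_pos hbox]
    have hE : E = Finsupp.single 1 (E 1) + Finsupp.single 2 (E 2) := by
      ext i; fin_cases i <;> simp [hbox.1]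
    rw [Finset.sum_eq_single (⟨⟨E 1, hbox.2.1⟩, ⟨E 2, hbox.2.2⟩⟩ : Fin α × Fin β)]
    · simp only
      rw [if_pos hE, ← hE]
    · rintro ⟨i, j⟩ - hne
      rw [if_neg]
      intro hE'
      apply hne
      have hi : (i : ℕ) = E 1 := by rw [hE']; simp
      have hj : (j : ℕ) = E 2 := by rw [hE']; simp
      ext <;> simp [hi, hj]
    · intro h; exact absurd (Finset.mem_univ _) h
  · rw [if_neg hbox]
    refine (Finset.sum_eq_zero fun p _ => if_neg fun hE => hbox ?_).symm
    rw [hE]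
    exact ⟨by simp, by simp, by simp⟩

/-- **GENERATION BY BOX POLYNOMIALS OVER `k⟦x⟧`.**  If `J ≠ R₃` is an ideal of `k⟦x,v,w⟧` with `v^α ∈ J + (x)` and `w^β ∈ J + (x)`,
then every series is congruent modulo `J` to `Σ_{i<α, j<β} r_{ij}(x)·v^i w^j` with `r_{ij} ∈ k⟦x⟧` (embedded along `x ↦ X 0`).
[Complete Nakayama `Matsumura1987_8_4` over the complete ring `k⟦x⟧` for the separated module `R₃ ⧸ J`.] -/
theorem exists_boxPoly_sub_mem {J : Ideal (MvPowerSeries (Fin 3) k)} (hJ : J ≠ ⊤) {α β : ℕ}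
    (hv : (X 1 : MvPowerSeries (Fin 3) k) ^ α ∈ J ⊔ Ideal.span {(X 0 : MvPowerSeries (Fin 3) k)})
    (hw : (X 2 : MvPowerSeries (Fin 3) k) ^ β ∈ J ⊔ Ideal.span {(X 0 : MvPowerSeries (Fin 3) k)})
    (F : MvPowerSeries (Fin 3) k) :
    ∃ c : Fin α × Fin β → MvPowerSeries (Fin 1) k,
      F - ∑ p, rename (fun _ : Fin 1 => (0 : Fin 3)) (c p) * (X 1 ^ (p.1 : ℕ) * X 2 ^ (p.2 : ℕ)) ∈ J := by
  classical
  haveI : Nontrivial (MvPowerSeries (Fin 3) k ⧸ J) := Ideal.Quotient.nontrivial_iff.mpr hJ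
  haveI : IsLocalRing (MvPowerSeries (Fin 3) k ⧸ J) := IsLocalRing.of_surjective' _ Ideal.Quotient.mk_surjective
  haveI : IsNoetherianRing (MvPowerSeries (Fin 3) k) :=
    Literature.AlgebraicGeometry.Resolution.isNoetherianRing_mvPowerSeries k (Fin 3)
  haveI : IsAdicComplete (maximalIdeal (MvPowerSeries (Fin 3) k)) (MvPowerSeries (Fin 3) k) :=
    WeierstrassForm.isAdicComplete_maximalIdeal k 3
  haveI hAq : IsAdicComplete (maximalIdeal (MvPowerSeries (Fin 3) k ⧸ J)) (MvPowerSeries (Fin 3) k ⧸ J) :=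
    Literature.AlgebraicGeometry.Resolution.isAdicComplete_quotient J
  haveI : IsAdicComplete (maximalIdeal (MvPowerSeries (Fin 1) k)) (MvPowerSeries (Fin 1) k) :=
    WeierstrassForm.isAdicComplete_maximalIdeal k 1
  let ι : MvPowerSeries (Fin 1) k →ₐ[k] MvPowerSeries (Fin 3) k := rename (fun _ : Fin 1 => (0 : Fin 3))
  let φ : MvPowerSeries (Fin 1) k →+* MvPowerSeries (Fin 3) k ⧸ J := (Ideal.Quotient.mk J).comp ι.toRingHom
  letI : Algebra (MvPowerSeries (Fin 1) k) (MvPowerSeries (Fin 3) k ⧸ J) := φ.toAlgebra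
  have halg : ∀ r, algebraMap (MvPowerSeries (Fin 1) k) (MvPowerSeries (Fin 3) k ⧸ J) r = Ideal.Quotient.mk J (ι r) :=
    fun r => rfl
  -- the structure map sends `𝔪_{k⟦x⟧}` into the maximal ideal
  have hloc : (maximalIdeal (MvPowerSeries (Fin 1) k)).map (algebraMap (MvPowerSeries (Fin 1) k) (MvPowerSeries (Fin 3) k ⧸ J)) ≤
      maximalIdeal (MvPowerSeries (Fin 3) k ⧸ J) := by
    rw [Ideal.map_le_iff_le_comap]
    intro r hr
    rw [Ideal.mem_comap, halg, IsLocalRing.mem_maximalIdeal, mem_nonunits_iff]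
    rw [WeierstrassForm.mem_maximalIdeal_iff] at hr
    intro hu
    have hu' : IsUnit (ι r) := (TOT2Branch.isUnit_mk_iff J hJ (ι r)).mp hu
    rw [isUnit_iff_constantCoeff, constantCoeff_rename, hr] at hu'
    exact not_isUnit_zero hu'
  -- `R₃ ⧸ J` is separated for the `𝔪_{k⟦x⟧}`-adic topology
  haveI : IsHausdorff (maximalIdeal (MvPowerSeries (Fin 1) k)) (MvPowerSeries (Fin 3) k ⧸ J) := by
    refine ⟨fun x hx => IsHausdorff.haus hAq.toIsHausdorff x fun n => ?_⟩
    have hxn := hx n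
    rw [SModEq.zero] at hxn ⊢
    rw [Ideal.smul_top_eq_map, Submodule.restrictScalars_mem, Ideal.map_pow] at hxn
    rw [smul_eq_mul, Ideal.mul_top]
    exact Ideal.pow_right_mono hloc n hxn
  -- generators: the box monomials
  let ω : Fin α × Fin β → MvPowerSeries (Fin 3) k ⧸ J := fun p => Ideal.Quotient.mk J (X 1 ^ (p.1 : ℕ) * X 2 ^ (p.2 : ℕ))
  have hxmem : ∀ G : MvPowerSeries (Fin 3) k, Ideal.Quotient.mk J (X 0 * G) ∈
      ((maximalIdeal (MvPowerSeries (Fin 1) k)) • ⊤ : Submodule (MvPowerSeries (Fin 1) k) (MvPowerSeries (Fin 3) k ⧸ J)) := by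
    intro G
    have : Ideal.Quotient.mk J (X 0 * G) = (X 0 : MvPowerSeries (Fin 1) k) • Ideal.Quotient.mk J G := by
      rw [Algebra.smul_def, halg, map_mul]
      congr 2
      exact (rename_X (fun _ : Fin 1 => (0 : Fin 3)) (0 : Fin 1)).symm
    rw [this]
    refine Submodule.smul_mem_smul ?_ Submodule.mem_top
    rw [WeierstrassForm.mem_maximalIdeal_iff, constantCoeff_X]
  have hpowmem : ∀ (P G : MvPowerSeries (Fin 3) k), P ∈ J ⊔ Ideal.span {(X 0 : MvPowerSeries (Fin 3) k)} →
      Ideal.Quotient.mk J (P * G) ∈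
        ((maximalIdeal (MvPowerSeries (Fin 1) k)) • ⊤ : Submodule (MvPowerSeries (Fin 1) k) (MvPowerSeries (Fin 3) k ⧸ J)) := by
    intro P G hP
    obtain ⟨j, hj, t, ht, hjt⟩ := Submodule.mem_sup.mp hP
    obtain ⟨u, rfl⟩ := Ideal.mem_span_singleton'.mp ht
    have : Ideal.Quotient.mk J (P * G) = Ideal.Quotient.mk J (X 0 * (u * G)) := by
      rw [← hjt, add_mul, map_add, (Ideal.Quotient.eq_zero_iff_mem).mpr (J.mul_mem_right G hj), zero_add]
      ring_nf
    rw [this]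
    exact hxmem _
  have hsup : Submodule.span (MvPowerSeries (Fin 1) k) (Set.range ω) ⊔
      ((maximalIdeal (MvPowerSeries (Fin 1) k)) • ⊤ : Submodule (MvPowerSeries (Fin 1) k) (MvPowerSeries (Fin 3) k ⧸ J)) = ⊤ := by
    refine Submodule.eq_top_iff'.mpr fun x => ?_
    obtain ⟨G, rfl⟩ := Ideal.Quotient.mk_surjective x
    obtain ⟨G₀, G₁, G₂, hG⟩ := exists_box_decomposition α β G
    rw [hG, map_add, map_add, map_add]
    refine Submodule.add_mem _ (Submodule.add_mem _ (Submodule.add_mem _ ?_ ?_) ?_) ?_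
    · refine Submodule.mem_sup_left ?_
      rw [map_sum]
      refine Submodule.sum_mem _ fun p _ => ?_
      have : Ideal.Quotient.mk J (C (coeff (Finsupp.single 1 (p.1 : ℕ) + Finsupp.single 2 (p.2 : ℕ)) G) *
          (X 1 ^ (p.1 : ℕ) * X 2 ^ (p.2 : ℕ))) =
          (C (coeff (Finsupp.single 1 (p.1 : ℕ) + Finsupp.single 2 (p.2 : ℕ)) G) : MvPowerSeries (Fin 1) k) • ω p := by
        rw [Algebra.smul_def, halg, rename_C, ← map_mul]
      rw [this]
      exact Submodule.smul_mem _ _ (Submodule.subset_span ⟨p, rfl⟩)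
    · exact Submodule.mem_sup_right (hxmem G₀)
    · exact Submodule.mem_sup_right (hpowmem _ G₁ hv)
    · exact Submodule.mem_sup_right (hpowmem _ G₂ hw)
  have htop := Literature.AlgebraicGeometry.Resolution.Matsumura1987_8_4 (maximalIdeal (MvPowerSeries (Fin 1) k)) ω hsup
  have hF : Ideal.Quotient.mk J F ∈ Submodule.span (MvPowerSeries (Fin 1) k) (Set.range ω) := by
    rw [htop]; exact Submodule.mem_top
  obtain ⟨c, hc⟩ := (Submodule.mem_span_range_iff_exists_fun (MvPowerSeries (Fin 1) k)).mp hF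
  refine ⟨c, ?_⟩
  rw [← Ideal.Quotient.eq_zero_iff_mem, map_sub, sub_eq_zero, map_sum, ← hc]
  refine Finset.sum_congr rfl fun p _ => ?_
  rw [Algebra.smul_def, halg, ← map_mul]

end TOT2Chart

end Summit.ResolutionOfSingularities.ResolutionOfSingularities.Theorems

end
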